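import Summits.Parity.GeneralizedHardyLittlewood.Theses.ZDegreeToeplitzBand
import Literature.NumberTheory.LFunctions.Zhang2022.KnifeEdgeLenLongLegSplit
import HarnessLib

/-!
# 𝒳₂ `LongPairsGradedTables` (stmt-Parity-20446): what the leg-split slots do NOT give for free (refuter desk, negative lemmas)

Route `ZDegreeToeplitzBand`, crux 𝒳₂ = `LongPairsGradedTables` (HELD); typed first rung of the crux card
`long-leg-split-chi-band` = `Zhang2022/KnifeEdgeLenLongLegSplit.lean` (slots `KnifeEdge.LongLegSplit.FormulaILongPsi`
(K2, Leg A), `FormulaILongDual` (K1, Leg B), `Lemma81LongPsi` (P2), `LegSplitTransferX2`; all OPEN, asserted by no one).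
Two kernel facts for the referee's LSR-541 battery:

* **Irrefutability.** Each slot is an (A)-guarded eventual statement, so a kernel `¬slot` exhibits Assumption (A)
  (`‖L(1,χ)‖ < log⁻²⁰²² D`) on real primitive characters beyond every `D₀`
  (`assumptionA_io_of_not_formulaILongPsi`, `…Dual`, `…lemma81LongPsi`, `…legSplitTransferX2`): none of the four can
  be closed `refuted` short of the summit's own negation, exactly as for 𝒳₂ itself (`DisplayConvergence.lean`).
* **The amplitude surcharge is exactly linear.** `FormulaILongPsi` is typed over the SUP-AMPLITUDE class
  (`‖b(n)‖ ≤ B·τ(n)²`, `B` fixed before `ForAllLarge`, additive slack `ε·𝔓`). `Theta1Ext`, `mainMVExt` are linear and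
  `EcalExt` absolutely homogeneous in the ψ-side datum (`Theta1Ext_const_mul_left`, `mainMVExt_const_mul_left`,
  `EcalExt_const_mul_left`), hence `formulaILongPsi_amp`: K2 yields, for data of amplitude `A·B·τ(n)²` with ANY `A > 0`
  chosen after `D`, the same estimate with slack `ε·A·𝔓` — no better. The 𝒳₂ cell's own ψ-datum is
  `a₁ = D·(δ_D ⋆ υ1_{≤D⁴} ⋆ χg ⋆ χf)` behind the prefactor `−χ(p)/τ(χ)`, `|τ(χ)| = √D` (K1A-DISPLAY-X2short §1 (5)), so a
  black-box use of K2 (at `A = D`) leaves `ε·√D·𝔓` on `conj τ₂`, against the tolerance `ε′·𝔞·𝔓` of `TauTwoTablePsi`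
  (`𝔞 = (6/π²)L′(1,χ)²∏q/(q+1) ≪ log⁴ D`): the typed `LegSplitTransferX2` carries an unexpressed `D^{1/2}` saving
  (the printed mechanism, (7.5)/(7.15), consumes `ℓ²(dm/m)`-type norms which regain `D^{−1/2}` on data supported on
  the multiples of `D`; the sup-class typing cannot express it). Nothing here is false; the rung under-delivers for
  its named customer until the slots are re-typed with a data-proportional slack or over the `D`-dilated class.

No definition is declared; standard axioms. «The programme SEARCHES and TYPES; no claim about Landau–Siegel
zeros, Theorems 1–2 of arXiv:2211.02515 or a repaired Margin232 until a kernel theorem says so.»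

## References

* [Zhang2022LandauSiegel] Y. Zhang, Discrete mean estimates and the Landau–Siegel zero, arXiv:2211.02515v1
  (2022): §2 p. 4 (Assumption (A)), §7 Prop. 7.1, (7.2), (7.3)–(7.5), (7.15), §8 Lemma 8.1, (8.5).
-/

noncomputable section

namespace Summit.Parity.GeneralizedHardyLittlewood.Theorems.LongPairsGradedTables.Negative

open Complex Real ComplexConjugate Finset
open Literature.NumberTheory.LFunctions.Zhang2022
open Literature.NumberTheory.LFunctions.Zhang2022.Skeleton
open Literature.NumberTheory.LFunctions.Zhang2022.Repair
open Literature.NumberTheory.LFunctions.Zhang2022.KnifeEdge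
open Literature.NumberTheory.LFunctions.Zhang2022.KnifeEdge.LongLegSplit

/-! ### Part 1 — irrefutability: `¬slot` puts (A) on infinitely many real primitive characters -/

/-- generic: the negation of an (A)-guarded eventual statement exhibits (A) beyond every `D₀`.
[cite: Zhang2022LandauSiegel, §2 p. 4 Assumption (A)] -/
theorem assumptionA_io_of_not_forAllLarge_guarded
    {S : (D : ℕ) → [NeZero D] → DirichletCharacter ℂ D → Prop}
    (h : ¬ ForAllLarge fun D _ χ => AssumptionA D χ → S D χ) (D₀ : ℕ) :
    ∃ (D : ℕ) (_ : NeZero D) (χ : DirichletCharacter ℂ D),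
      D₀ ≤ D ∧ χ.IsQuadratic ∧ χ.IsPrimitive ∧ AssumptionA D χ := by
  by_contra hc
  push Not at hc
  exact h ⟨D₀, fun D _ χ hD hq hp hA => (hc D ‹_› χ hD hq hp hA).elim⟩

/-- A kernel refutation of Leg A (`FormulaILongPsi`) exhibits (A) infinitely often.
[cite: Zhang2022LandauSiegel, §2 p. 4, §7 Prop. 7.1] -/
theorem assumptionA_io_of_not_formulaILongPsi {c' : ℝ} (h : ¬ FormulaILongPsi c') (D₀ : ℕ) :
    ∃ (D : ℕ) (_ : NeZero D) (χ : DirichletCharacter ℂ D),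
      D₀ ≤ D ∧ χ.IsQuadratic ∧ χ.IsPrimitive ∧ AssumptionA D χ := by
  unfold FormulaILongPsi at h
  push Not at h
  obtain ⟨B, ε, _, hC⟩ := h
  exact assumptionA_io_of_not_forAllLarge_guarded (hC 0) D₀

/-- A kernel refutation of Leg B (`FormulaILongDual`) exhibits (A) infinitely often.
[cite: Zhang2022LandauSiegel, §2 p. 4, §7 Prop. 7.1] -/
theorem assumptionA_io_of_not_formulaILongDual {c' : ℝ} (h : ¬ FormulaILongDual c') (D₀ : ℕ) :
    ∃ (D : ℕ) (_ : NeZero D) (χ : DirichletCharacter ℂ D),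
      D₀ ≤ D ∧ χ.IsQuadratic ∧ χ.IsPrimitive ∧ AssumptionA D χ := by
  unfold FormulaILongDual at h
  push Not at h
  obtain ⟨B, ε, _, hC⟩ := h
  exact assumptionA_io_of_not_forAllLarge_guarded (hC 0) D₀

/-- A kernel refutation of the extended Lemma 8.1 (`Lemma81LongPsi`) exhibits (A) infinitely often.
[cite: Zhang2022LandauSiegel, §2 p. 4, §8 Lemma 8.1] -/
theorem assumptionA_io_of_not_lemma81LongPsi {c' : ℝ} (h : ¬ Lemma81LongPsi c') (D₀ : ℕ) :
    ∃ (D : ℕ) (_ : NeZero D) (χ : DirichletCharacter ℂ D),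
      D₀ ≤ D ∧ χ.IsQuadratic ∧ χ.IsPrimitive ∧ AssumptionA D χ := by
  unfold Lemma81LongPsi at h
  push Not at h
  obtain ⟨δ, _, B, ε, _, hC⟩ := h
  exact assumptionA_io_of_not_forAllLarge_guarded hC D₀

/-- A kernel refutation of a ψ-graded cross table with ANY named functional exhibits (A) infinitely often.
[cite: Zhang2022LandauSiegel, §2 p. 4, §8 (8.5)] -/
theorem assumptionA_io_of_not_crossTablePsi {c' : ℝ} {d : ℕ} {X : PairFunctional}
    (h : ¬ CrossTablePsi c' d X) (D₀ : ℕ) :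
    ∃ (D : ℕ) (_ : NeZero D) (χ : DirichletCharacter ℂ D),
      D₀ ≤ D ∧ χ.IsQuadratic ∧ χ.IsPrimitive ∧ AssumptionA D χ := by
  unfold CrossTablePsi at h
  push Not at h
  obtain ⟨f, f', g, g', _, _, ε, _, hC⟩ := h
  exact assumptionA_io_of_not_forAllLarge_guarded hC D₀

/-- A kernel refutation of the transfer shape (`LegSplitTransferX2`) exhibits (A) infinitely often (it would refute
the `X₂` table for EVERY functional, in particular `0`). [cite: Zhang2022LandauSiegel, §2 p. 4, §8 (8.5), Lemma 8.1] -/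
theorem assumptionA_io_of_not_legSplitTransferX2 {c' : ℝ} (h : ¬ LegSplitTransferX2 c') (D₀ : ℕ) :
    ∃ (D : ℕ) (_ : NeZero D) (χ : DirichletCharacter ℂ D),
      D₀ ≤ D ∧ χ.IsQuadratic ∧ χ.IsPrimitive ∧ AssumptionA D χ := by
  unfold LegSplitTransferX2 at h
  push Not at h
  obtain ⟨_, _, hX⟩ := h
  exact assumptionA_io_of_not_crossTablePsi (c' := c') (d := 2) (X := fun _ _ _ _ => 0) (hX _) D₀

/-! ### Part 2 — homogeneity of the extended formula-I objects in the ψ-side datum -/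

section Homogeneity

variable (c' : ℝ) {D : ℕ} (χ : DirichletCharacter ℂ D)

/-- `A(c·𝐚;s,ψ) = c·A(𝐚;s,ψ)`. [cite: Zhang2022LandauSiegel, §7 p. 13] -/
theorem dirPoly_const_mul {k : ℕ} (N : ℕ) (c : ℂ) (a : ℕ → ℂ) (ψ : DirichletCharacter ℂ k) (s : ℂ) :
    Lemma81.dirPoly N (fun n => c * a n) ψ s = c * Lemma81.dirPoly N a ψ s := by
  simp only [Lemma81.dirPoly_def, Finset.mul_sum]
  exact Finset.sum_congr rfl fun n _ => by ring

/-- The segment integral is linear in the integrand (no integrability needed). [cite: Zhang2022LandauSiegel, §7 p. 13] -/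
theorem segInt_const_mul (t₀ L₁ : ℝ) (z c : ℂ) (F : ℂ → ℂ) :
    Lemma81.segInt t₀ L₁ z (fun s => c * F s) = c * Lemma81.segInt t₀ L₁ z F := by
  simp only [Lemma81.segInt_def]
  rw [intervalIntegral.integral_const_mul]
  ring

/-- `Θ₁` with extended truncations is linear in `𝐚₁`. [cite: Zhang2022LandauSiegel, §7 Prop. 7.1] -/
theorem Theta1Ext_const_mul_left (N₁ N₂ : ℕ) (c : ℂ) (a₁ a₂ : ℕ → ℂ) :
    Theta1Ext c' χ N₁ N₂ (fun n => c * a₁ n) a₂ = c * Theta1Ext c' χ N₁ N₂ a₁ a₂ := by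
  unfold Theta1Ext
  rw [Finset.mul_sum]
  refine Finset.sum_congr rfl fun x _ => ?_
  rw [← segInt_const_mul]
  congr 1
  funext s
  rw [dirPoly_const_mul]
  ring

/-- `S_j` with extended ranges is linear in `𝐚₁`. [cite: Zhang2022LandauSiegel, §7 Prop. 7.1] -/
theorem SjExt_const_mul_left (D N₁ N₂ j : ℕ) (c : ℂ) (a₁ a₂ : ℕ → ℂ) :
    SjExt c' D N₁ N₂ j (fun n => c * a₁ n) a₂ = c * SjExt c' D N₁ N₂ j a₁ a₂ := by
  unfold SjExt
  rw [Finset.mul_sum]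
  refine Finset.sum_congr rfl fun d _ => ?_
  rw [Finset.mul_sum]
  refine Finset.sum_congr rfl fun r _ => ?_
  have hm : (∑ m ∈ Finset.Ico 1 N₁, c * a₁ (d * r * m) / (m : ℂ) ^ (1 - betaJ c' D j))
      = c * ∑ m ∈ Finset.Ico 1 N₁, a₁ (d * r * m) / (m : ℂ) ^ (1 - betaJ c' D j) := by
    rw [Finset.mul_sum]
    exact Finset.sum_congr rfl fun m _ => by ring
  rw [hm]
  ring

/-- `E(c·𝐚₁,𝐚₂) = |c|·E(𝐚₁,𝐚₂)` (extended ranges). [cite: Zhang2022LandauSiegel, §7 Prop. 7.1] -/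
theorem EcalExt_const_mul_left (D N₁ N₂ : ℕ) (c : ℂ) (a₁ a₂ : ℕ → ℂ) :
    EcalExt c' D N₁ N₂ (fun n => c * a₁ n) a₂ = ‖c‖ * EcalExt c' D N₁ N₂ a₁ a₂ := by
  unfold EcalExt
  simp only [SjExt_const_mul_left, norm_mul]
  ring

/-- The main term with extended ranges is linear in `𝐚₁`. [cite: Zhang2022LandauSiegel, §7 Prop. 7.1] -/
theorem mainMVExt_const_mul_left (D N₁ N₂ : ℕ) (c : ℂ) (a₁ a₂ : ℕ → ℂ) :
    mainMVExt c' D N₁ N₂ (fun n => c * a₁ n) a₂ = c * mainMVExt c' D N₁ N₂ a₁ a₂ := by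
  unfold mainMVExt
  simp only [SjExt_const_mul_left]
  ring

/-- `𝐚₁ = b ⋆ (χg̃) ⋆ (χf̃)` is linear in `b`, as a function. [cite: Zhang2022LandauSiegel, §8 (8.8)] -/
theorem longPsiData_const_mul_fun (c : ℂ) (b : ℕ → ℂ) (g f : ℝ → ℂ) :
    longPsiData χ (fun m => c * b m) g f = fun n => c * longPsiData χ b g f n :=
  funext fun n => longPsiData_const_mul χ c b g f n

end Homogeneity

/-! ### Part 3 — the amplitude surcharge of Leg A is exactly linear -/

/-- **`FormulaILongPsi` at amplitude `A`: the exact linear image.** From K2 (sup-amplitude class `‖b(n)‖ ≤ B·τ(n)²`,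
slack `ε·𝔓`) one gets, for every `A > 0` chosen AFTER `D` (e.g. `A = D`, the 𝒳₂ cell's `D·δ_D` factor) and data with
`‖b(n)‖ ≤ A·B·τ(n)²`, the same estimate with slack `ε·A·𝔓` — by applying K2 to `b/A`; a black box gives no more.
With the cell prefactor `|τ(χ)|⁻¹ = D^{−1/2}` this is `ε·√D·𝔓` on `conj τ₂` at `A = D`, not `o(𝔞𝔓)`.
[cite: Zhang2022LandauSiegel, §7 Prop. 7.1, (7.2), (7.5); §8 Lemma 8.1, (8.5)] -/
theorem formulaILongPsi_amp {c' : ℝ} (h : FormulaILongPsi c') :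
    ∀ B : ℝ, ∀ ε : ℝ, 0 < ε → ∃ C : ℝ, ForAllLarge fun D _ χ => AssumptionA D χ →
      ∀ (A : ℝ), 0 < A → ∀ (b : ℕ → ℂ) (g g' f f' : ℝ → ℂ) (a₂ : ℕ → ℂ),
        InClassPiece g g' → InClassPiece f f' →
        (∀ x ∈ Set.Icc (0:ℝ) 1, ‖g x‖ ≤ 1) → (∀ x ∈ Set.Icc (0:ℝ) 1, ‖f x‖ ≤ 1) →
        (∀ n, ‖b n‖ ≤ A * B * ((Nat.divisors n).card : ℝ) ^ 2) → (∀ n : ℕ, D ^ 5 < n → b n = 0) →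
        Adm72 D B a₂ →
          ‖Theta1Ext c' χ (Nlong D) (Nsupp D) (longPsiData χ b g f) a₂
              - mainMVExt c' D (Nlong D) (Nsupp D) (longPsiData χ b g f) a₂‖
            ≤ C * EcalExt c' D (Nlong D) (Nsupp D) (longPsiData χ b g f) a₂ + ε * A * frakP D := by
  intro B ε hε
  obtain ⟨C, D₀, hD₀⟩ := h B ε hε
  refine ⟨C, D₀, fun D _ χ hD hq hp hA A hApos b g g' f f' a₂ hg hf hg1 hf1 hb hb0 ha₂ => ?_⟩
  -- the rescaled datum `b/A` lies in the sup-amplitude class of K2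
  have hb'1 : ∀ n, ‖(A : ℂ)⁻¹ * b n‖ ≤ B * ((Nat.divisors n).card : ℝ) ^ 2 := by
    intro n
    rw [norm_mul, norm_inv, Complex.norm_real, Real.norm_eq_abs, abs_of_pos hApos, inv_mul_le_iff₀ hApos]
    calc ‖b n‖ ≤ A * B * ((Nat.divisors n).card : ℝ) ^ 2 := hb n
      _ = A * (B * ((Nat.divisors n).card : ℝ) ^ 2) := by ring
  have hb'0 : ∀ n : ℕ, D ^ 5 < n → (A : ℂ)⁻¹ * b n = 0 := fun n hn => by rw [hb0 n hn, mul_zero]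
  have key := hD₀ D χ hD hq hp hA (fun n => (A : ℂ)⁻¹ * b n) g g' f f' a₂ hg hf hg1 hf1 hb'1 hb'0 ha₂
  rw [longPsiData_const_mul_fun, Theta1Ext_const_mul_left, mainMVExt_const_mul_left, EcalExt_const_mul_left,
    ← mul_sub, norm_mul, norm_inv, Complex.norm_real, Real.norm_eq_abs, abs_of_pos hApos] at key
  -- key : A⁻¹·‖Θ − M‖ ≤ C·(A⁻¹·E) + ε·𝔓; multiply through by A
  have hmul := mul_le_mul_of_nonneg_left key hApos.le
  rw [← mul_assoc, mul_inv_cancel₀ hApos.ne', one_mul] at hmul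
  calc _ ≤ A * (C * (A⁻¹ * EcalExt c' D (Nlong D) (Nsupp D) (longPsiData χ b g f) a₂) + ε * frakP D) := hmul
    _ = C * EcalExt c' D (Nlong D) (Nsupp D) (longPsiData χ b g f) a₂ + ε * A * frakP D := by
        field_simp

/-- Conversely K2 is its amplitude-`1` instance: the sup-class slot carries EXACTLY amplitude-linear information.
[cite: Zhang2022LandauSiegel, §7 Prop. 7.1, (7.2)] -/
theorem formulaILongPsi_iff_amp (c' : ℝ) :
    FormulaILongPsi c' ↔
    ∀ B : ℝ, ∀ ε : ℝ, 0 < ε → ∃ C : ℝ, ForAllLarge fun D _ χ => AssumptionA D χ →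
      ∀ (A : ℝ), 0 < A → ∀ (b : ℕ → ℂ) (g g' f f' : ℝ → ℂ) (a₂ : ℕ → ℂ),
        InClassPiece g g' → InClassPiece f f' →
        (∀ x ∈ Set.Icc (0:ℝ) 1, ‖g x‖ ≤ 1) → (∀ x ∈ Set.Icc (0:ℝ) 1, ‖f x‖ ≤ 1) →
        (∀ n, ‖b n‖ ≤ A * B * ((Nat.divisors n).card : ℝ) ^ 2) → (∀ n : ℕ, D ^ 5 < n → b n = 0) →
        Adm72 D B a₂ →
          ‖Theta1Ext c' χ (Nlong D) (Nsupp D) (longPsiData χ b g f) a₂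
              - mainMVExt c' D (Nlong D) (Nsupp D) (longPsiData χ b g f) a₂‖
            ≤ C * EcalExt c' D (Nlong D) (Nsupp D) (longPsiData χ b g f) a₂ + ε * A * frakP D := by
  refine ⟨formulaILongPsi_amp, fun h B ε hε => ?_⟩
  obtain ⟨C, D₀, hD₀⟩ := h B ε hε
  refine ⟨C, D₀, fun D _ χ hD hq hp hA b g g' f f' a₂ hg hf hg1 hf1 hb hb0 ha₂ => ?_⟩
  have := hD₀ D χ hD hq hp hA 1 one_pos b g g' f f' a₂ hg hf hg1 hf1 (fun n => by rw [one_mul]; exact hb n) hb0 ha₂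
  simpa only [mul_one, one_mul] using this

end Summit.Parity.GeneralizedHardyLittlewood.Theorems.LongPairsGradedTables.Negative

end
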